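import Summits.ResolutionOfSingularities.ResolutionOfSingularities.Theorems.HilbertSamuelEliminationCampaignW42TertiaryStrictTransformParts
import Mathlib.Topology.NoetherianSpace
import HarnessLib

/-!
# Route `HilbertSamuelElimination`, crux `SigmaMaxModificationsCorridor3` (stmt-ResolutionOfSingularities-19249;
# child of `SigmaMaxModifications` stmt-…-18506), registered skeleton `w_ladder` v5 MOVING (e55bf4f23146f08b),
# stub `stub_movingCompactness` (L∞) — second layer, HELPER STUBS 1 + 2 of idea-2's line `moving-compactness`
# (`L/res-L1-w42-idea-2/Line-moving-compactness.lean` 89d540dcceefd65f): THE LEAST LABEL PRESENT is monotone along a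
# chain of canonical near steps, and a chain along which it is unbounded is MOVING

[OURS · L1 W4.2] (cell res-hironaka, LADDER-RESOLUTION rung L, D-0089; volunteer prover seat res-type-005 gen 6, holder of
helpers 1+2 by res-L1-w42-plan-1's word 2026-08-27T04:28:23Z under CHAIN v3.7 §0f (S2); helper 3 (Kőnig) is res-type-064's).
NOT statements of H. Hironaka's manuscript [Hironaka2017]; nothing of the manuscript is used or asserted. AI-written,
weaker than expert review. `leastLabel`, `stub_leastLabel_monotone`, `stub_moving_of_leastLabel_unbounded` are VERBATIM
(name, namespace, signature) the line's, so that helper 3 and the line's PROVED composition `movingCompactness_of_stubs` /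
`MovingCompactness_of` consume them by name.

THE CONTENT (CJS Rem. 6.29 (1), (6.5): the label calculus of `S(X, ν)`, in the tree's rendering `Labelling.init/next/part`,
`CampaignW42.MarkedStage` / `CanonicalNearStep`).

* STUB 1 `stub_leastLabel_monotone`. Along a chain `c` of canonical near steps from `MarkedStage.init X x`, `x ∈ X(ν)`, the
  least `i` with `Y_n^{(i)} ≠ ∅` is monotone in `n`. Two invariants carry it: (a) every label is `≤` the year (`init`: all
  `0`; `next`: a component inherits a label of the previous stage or gets the new year); (b) the marked point lies in the
  `ν`-stratum of its stage (`CanonicalNearStep` chooses it there — this also makes the stratum non-empty, so the `sInf` in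
  `leastLabel` is attained and never the junk value). At a step, a component of `Y_{n+1}` realising the least label either
  DOMINATES a component of `Y_n` and inherits its label — a label PRESENT at stage `n` — or gets `year + 1`, which exceeds
  the label of the component of `Y_n` through the marked point. Uses neither the oracle nor `StateGood`.
* STUB 2 `stub_moving_of_leastLabel_unbounded`. Along a WAITING step (marked point off the centre, `¬ IsBlownUp`) from a
  good state, the component of `X_n(ν)` through `x_n` is dominated by a component of `X_{n+1}(ν)` through `x_{n+1}`, which
  inherits its label: the blow-up is an isomorphism off the centre, the strict transform of the component is irreducible
  (`CampaignW42.isIrreducible_strictTransformSet_of_not_subset`) and lies in the closed next stratum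
  (`strictTransformSet_subset_hsStratum`, `StateGood.next`), hence in one of its finitely many components, whose image
  closure is the component downstairs by maximality — the pointwise form of the `⊇` half of
  `CampaignW42.next_part_eq_strictTransformSet`. So a chain waiting from stage `n₀` on carries a FIXED label at its marked
  points, its least label present is bounded (by STUB 1 below `n₀` too); contrapositive = STUB 2. Uses `StateGood`
  (closed strata, Noetherian stages, `H^N` monotone), not the oracle.

## Sources

* V. Cossart, U. Jannsen, S. Saito, *Desingularization: Invariants and Strategy*, LNM 2270 (2020), Rem. 6.29 (1)
  pp. 91–92, (6.5). [CossartJannsenSaito2020]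
* U. Görtz, T. Wedhorn, *Algebraic Geometry I* (2nd ed. 2020), Prop. 13.91 (3), (13.19) p. 414. [GortzWedhorn2020]
* tree: `Literature.AlgebraicGeometry.Resolution.Labelling` (`init`, `part`, `next`, `next_label_of_mem`,
  `next_label_of_not_mem`, `mem_part_iff`, `subset_part`, `exists_part_nonempty_iff`), `componentsIn`, `strictTransformSet`,
  `exists_apply_eq_of_isIso_morphismRestrict`; `CampaignW42.MarkedStage` / `CanonicalNearStep` / `MarkedStage.IsBlownUp`
  (…CampaignW42Tertiary), `CanonicalNearStep.pt_mem_hsStratum` (…TertiaryReduction), `CampaignW42.StateGood` (…TertiaryStates), `CampaignW42.hsFun_blowup_eq_of_notMem_support` /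
  `strictTransformSet_subset_hsStratum` (…TertiaryInStratum), `CampaignW42.exists_componentsIn_superset` /
  `isIrreducible_strictTransformSet_of_not_subset` (…TertiaryStrictTransformParts).
-/

set_option linter.dupNamespace false -- mandated namespace of this single-conjunct summit

noncomputable section

open CategoryTheory AlgebraicGeometry TopologicalSpace Topology
open Summit.ResolutionOfSingularities.ResolutionOfSingularities.Theorems.CampaignW42
open Literature.AlgebraicGeometry.Resolution Literature.RingTheory.HilbertSamuel

namespace Summit.ResolutionOfSingularities.ResolutionOfSingularities.Cruxes.SigmaMaxModifications.MovingCompactnessLine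

universe u

variable {R : ∀ S : Scheme.{u}, CentreSeq S → Prop} {N : ℕ} {ν : ℕ → ℕ}

/-! ## The least label present (CJS (6.5)) -/

/-- [OURS] THE LEAST LABEL PRESENT at a marked stage: the least `i` with `Y_n^{(i)} ≠ ∅` (CJS (6.5); `0` if the stratum is empty).
[cite: CossartJannsenSaito2020, Rem. 6.29 (1), (6.5)] -/
def leastLabel (N : ℕ) (ν : ℕ → ℕ) (s : MarkedStage.{u}) : ℕ :=
  sInf {i | (s.L.part (Scheme.hsStratum s.W N ν) i).Nonempty}

/-- The least label present is `≤` every label of a component of the stratum. [folklore] -/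
theorem leastLabel_le_label (N : ℕ) (ν : ℕ → ℕ) (s : MarkedStage.{u}) {Z : Set s.W}
    (hZ : Z ∈ componentsIn (Scheme.hsStratum s.W N ν)) : leastLabel N ν s ≤ s.L.label Z :=
  Nat.sInf_le ((componentsIn.nonempty hZ).mono (s.L.subset_part hZ rfl))

/-- If the stratum of the stage is non-empty, the least label present is realised by a component of the stratum.
[folklore] -/
theorem exists_component_label_eq_leastLabel (N : ℕ) (ν : ℕ → ℕ) (s : MarkedStage.{u})
    (hne : (Scheme.hsStratum s.W N ν).Nonempty) :
    ∃ Z ∈ componentsIn (Scheme.hsStratum s.W N ν), s.L.label Z = leastLabel N ν s := by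
  have hS : {i | (s.L.part (Scheme.hsStratum s.W N ν) i).Nonempty}.Nonempty :=
    (s.L.exists_part_nonempty_iff _).mpr hne
  obtain ⟨y, hy⟩ := Nat.sInf_mem hS
  obtain ⟨Z, hZ, hlab, -⟩ := (s.L.mem_part_iff _ _ y).mp hy
  exact ⟨Z, hZ, hlab⟩

/-! ## Invariant (a): labels never exceed the year -/

/-- The initial stage has all labels `0 ≤ 0`. [cite: CossartJannsenSaito2020, Rem. 6.29 (1)] -/
theorem label_le_year_init (X : Scheme.{u}) [IsLocallyNoetherian X] (x : X) (Z : Set (MarkedStage.init X x).W) :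
    (MarkedStage.init X x).L.label Z ≤ (MarkedStage.init X x).L.year :=
  le_rfl

/-- A canonical near step preserves «labels `≤` year»: a component of the next stratum inherits a label of the previous
stage (`≤ year ≤ year + 1`) or gets the label `year + 1`. [cite: CossartJannsenSaito2020, Rem. 6.29 (1)] -/
theorem label_le_year_step {s s' : MarkedStage.{u}} (hst : CanonicalNearStep R N ν s s')
    (h : ∀ Z : Set s.W, s.L.label Z ≤ s.L.year) (Z : Set s'.W) : s'.L.label Z ≤ s'.L.year := by
  obtain ⟨C, P', hln, x', -, -, -, -, rfl⟩ := hst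
  show (s.L.next (Scheme.hsStratum s.W N ν) C).label Z ≤ (s.L.next (Scheme.hsStratum s.W N ν) C).year
  rw [Labelling.next_year]
  by_cases hdom : closure (blowup.π C '' Z) ∈ componentsIn (Scheme.hsStratum s.W N ν)
  · rw [Labelling.next_label_of_mem _ _ hdom]
    exact (h _).trans (Nat.le_succ _)
  · rw [Labelling.next_label_of_not_mem _ _ hdom]

/-! ## Invariant (b): the marked point lies in the stratum -/

/-- At the initial stage this is the hypothesis `x ∈ X(ν)`. [folklore] -/
theorem pt_mem_hsStratum_init {X : Scheme.{u}} [IsLocallyNoetherian X] {x : X}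
    (hx : x ∈ Scheme.hsStratum X N ν) :
    (MarkedStage.init X x).pt ∈ Scheme.hsStratum (MarkedStage.init X x).W N ν :=
  hx

/-! ## One step: the least label present does not decrease -/

/-- **One canonical near step does not decrease the least label present** (given the two invariants at the source).
[cite: CossartJannsenSaito2020, Rem. 6.29 (1), (6.5)] -/
theorem leastLabel_le_of_step {s s' : MarkedStage.{u}} (hst : CanonicalNearStep R N ν s s')
    (hlab : ∀ Z : Set s.W, s.L.label Z ≤ s.L.year) (hpt : s.pt ∈ Scheme.hsStratum s.W N ν) :
    leastLabel N ν s ≤ leastLabel N ν s' := by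
  have hpt' : s'.pt ∈ Scheme.hsStratum s'.W N ν := hst.pt_mem_hsStratum
  obtain ⟨C, P', hln, x', -, -, -, hx', rfl⟩ := hst
  -- a component `Z` of the next stratum realising the least label present there
  obtain ⟨Z, hZ, hZlab⟩ := exists_component_label_eq_leastLabel N ν _ ⟨_, hpt'⟩
  rw [← hZlab]
  show leastLabel N ν s ≤ (s.L.next (Scheme.hsStratum s.W N ν) C).label Z
  by_cases hdom : closure (blowup.π C '' Z) ∈ componentsIn (Scheme.hsStratum s.W N ν)
  · -- `Z` dominates a component of `Y_n` and inherits its label, a label PRESENT at stage `n`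
    rw [Labelling.next_label_of_mem _ _ hdom]
    exact leastLabel_le_label N ν s hdom
  · -- `Z` gets the new year, which exceeds the label of the component of `Y_n` through the marked point
    rw [Labelling.next_label_of_not_mem _ _ hdom]
    obtain ⟨Z₀, hZ₀, -⟩ := componentsIn.exists_mem hpt
    exact ((leastLabel_le_label N ν s hZ₀).trans (hlab Z₀)).trans (Nat.le_succ _)

/-! ## Along a chain -/

/-- Both invariants hold all along a chain of canonical near steps from `MarkedStage.init X x`, `x ∈ X(ν)`. [folklore] -/
theorem invariants_of_chain {X : Scheme.{u}} [IsLocallyNoetherian X] {x : X} (hx : x ∈ Scheme.hsStratum X N ν)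
    {c : ℕ → MarkedStage.{u}} (h0 : c 0 = MarkedStage.init X x)
    (hstep : ∀ n, CanonicalNearStep R N ν (c n) (c (n + 1))) (n : ℕ) :
    (∀ Z : Set (c n).W, (c n).L.label Z ≤ (c n).L.year) ∧ (c n).pt ∈ Scheme.hsStratum (c n).W N ν := by
  induction n with
  | zero =>
    rw [h0]
    exact ⟨label_le_year_init X x, pt_mem_hsStratum_init hx⟩
  | succ n ih => exact ⟨label_le_year_step (hstep n) ih.1, (hstep n).pt_mem_hsStratum⟩

/-- **The least label present is monotone along a chain of canonical near steps from `MarkedStage.init X x`,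
`x ∈ X(ν)`** (hypothesis-light form). [cite: CossartJannsenSaito2020, Rem. 6.29 (1), (6.5)] -/
theorem leastLabel_monotone_of_chain {X : Scheme.{u}} [IsLocallyNoetherian X] {x : X}
    (hx : x ∈ Scheme.hsStratum X N ν) {c : ℕ → MarkedStage.{u}} (h0 : c 0 = MarkedStage.init X x)
    (hstep : ∀ n, CanonicalNearStep R N ν (c n) (c (n + 1))) :
    Monotone fun n => leastLabel N ν (c n) :=
  monotone_nat_of_le_succ fun n =>
    leastLabel_le_of_step (hstep n) (invariants_of_chain hx h0 hstep n).1 (invariants_of_chain hx h0 hstep n).2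

/-- **STUB 1 of the line `moving-compactness`, BY NAME AND SIGNATURE** (idea-2
`Line-moving-compactness.lean` 89d540dcceefd65f): the least label present is monotone along a
chain of canonical near steps from a good initial state. The oracle, `StateGood` and closedness hypotheses are not used (binders `_hRf`, `_hgood`,
`_hxcl`: the TYPE is the line's verbatim; only the unused binder names carry the lint underscore).
[cite: CossartJannsenSaito2020, Rem. 6.29 (1), p. 92] -/
theorem stub_leastLabel_monotone {k : Type u} [Field k] (_hRf : OracleFunctional R) {X : Scheme.{u}}
    [IsLocallyNoetherian X] (_hgood : StateGood k R N ν X (Labelling.init X) none) {x : X}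
    (hx : x ∈ Scheme.hsStratum X N ν) (_hxcl : IsClosed ({x} : Set X)) {c : ℕ → MarkedStage.{u}}
    (h0 : c 0 = MarkedStage.init X x) (hstep : ∀ n, CanonicalNearStep R N ν (c n) (c (n + 1))) :
    Monotone fun n => leastLabel N ν (c n) :=
  leastLabel_monotone_of_chain hx h0 hstep


/-! ## STUB 2: waiting for ever bounds the least label present

Along a WAITING step (the marked point is not blown up: it lies off the centre) the component of the stratum through
the marked point is DOMINATED by a component of the next stratum through the next marked point, which therefore
inherits its label (`Labelling.next`): the blow-up is an isomorphism off the centre, the strict transform of the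
component is irreducible and lies in the (closed) next stratum, hence in one of its finitely many components, whose
image closure is the component we started from (maximality). So a chain that waits from stage `n₀` on carries a FIXED
label `ℓ` at its marked points, and the least label present stays `≤ ℓ`; by monotonicity (STUB 1) it is `≤ ℓ` before
`n₀` too. Contrapositive: an unbounded least label forces the marked point to be blown up infinitely often. -/

section Waiting

variable {k : Type u} [Field k]

/-- **Off the centre, a component downstairs is dominated by a component upstairs through any of its lifted points.**
Data: the blow-up `π : Bl_C(W) → W`; closed `Y ⊆ W`, closed `Y' ⊆ Bl_C(W)` with finitely many irreducible components,
`π(Y') ⊆ Y`, and the strict transform of every subset of `Y` inside `Y'`; a component `Z` of `Y` and a point `y`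
upstairs with `π y ∈ Z ∖ V(C)`. Then some component `Z₁ ∋ y` of `Y'` has `closure π(Z₁) = Z`. (The argument of the `⊇`
half of `CampaignW42.next_part_eq_strictTransformSet`, pointwise.) [cite: GortzWedhorn2020, Prop. 13.91 (3), (13.19) p. 414] -/
theorem exists_component_dominating_of_notMem_support {W : Scheme.{u}} (C : W.IdealSheafData) {Y : Set W}
    (hY : IsClosed Y) {Y' : Set ↥(blowup C)} (hY' : IsClosed Y') (hfin' : (componentsIn Y').Finite)
    (hπY' : (blowup.π C).base '' Y' ⊆ Y)
    (hST : ∀ T, T ⊆ Y → strictTransformSet (blowup.π C) (C.support : Set W) T ⊆ Y')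
    {Z : Set W} (hZ : Z ∈ componentsIn Y) {y : ↥(blowup C)} (hyZ : (blowup.π C).base y ∈ Z)
    (hyE : (blowup.π C).base y ∉ (C.support : Set W)) :
    ∃ Z₁ ∈ componentsIn Y', y ∈ Z₁ ∧ closure (blowup.π C '' Z₁) = Z := by
  haveI : IsIso (blowup.π C ∣_ ⟨(C.support : Set W)ᶜ, C.support.isClosed.isOpen_compl⟩) :=
    (blowup.isBlowup C).isIso_compl
  have hZE : ¬ Z ⊆ (C.support : Set W) := fun h => hyE (h hyZ)
  have hAirr : IsIrreducible (strictTransformSet (blowup.π C) (C.support : Set W) Z) :=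
    isIrreducible_strictTransformSet_of_not_subset C (componentsIn.isIrreducible hZ) hZE
  have hAY' : strictTransformSet (blowup.π C) (C.support : Set W) Z ⊆ Y' := hST Z (componentsIn.subset hZ)
  obtain ⟨Z₁, hZ₁, hAZ₁⟩ := exists_componentsIn_superset hY' hfin' hAirr hAY'
  have hyZ₁ : y ∈ Z₁ :=
    hAZ₁ (strictTransformSet.preimage_diff_subset (blowup.π C) (C.support : Set W) Z ⟨hyZ, hyE⟩)
  refine ⟨Z₁, hZ₁, hyZ₁, ?_⟩
  -- `closure π(Z₁) = Z` by maximality of the component `Z`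
  have hsub1 : closure (blowup.π C '' Z₁) ⊆ Y :=
    closure_minimal ((Set.image_mono (componentsIn.subset hZ₁)).trans hπY') hY
  have hirr1 : IsIrreducible (closure (blowup.π C '' Z₁)) :=
    ((componentsIn.isIrreducible hZ₁).image _ (blowup.π C).continuous.continuousOn).closure
  have hsub2 : Z ⊆ closure (blowup.π C '' Z₁) := by
    have hd : Z ⊆ closure (Z ∩ (C.support : Set W)ᶜ) :=
      subset_closure_inter_of_isPreirreducible_of_isOpen (componentsIn.isIrreducible hZ).isPreirreducible
        C.support.isClosed.isOpen_compl ⟨(blowup.π C).base y, hyZ, hyE⟩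
    refine hd.trans (closure_mono ?_)
    rintro w ⟨hwZ, hwE⟩
    obtain ⟨x, hx⟩ :=
      exists_apply_eq_of_isIso_morphismRestrict (blowup.π C) ⟨(C.support : Set W)ᶜ, _⟩ hwE
    refine ⟨x, hAZ₁ (strictTransformSet.preimage_diff_subset (blowup.π C) (C.support : Set W) Z ?_), hx⟩
    show (blowup.π C).base x ∈ Z \ (C.support : Set W)
    rw [show (blowup.π C).base x = w from hx]
    exact ⟨hwZ, hwE⟩
  exact Set.Subset.antisymm ((mem_componentsIn_iff.mp hZ).2.2 _ hsub1 hirr1 hsub2) hsub2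

/-- **A WAITING canonical near step from a good state carries the label at the marked point upstairs**: if the marked
point `x_n` is not blown up and lies on the component `Z` of `X_n(ν)`, then `x_{n+1}` lies on a component of
`X_{n+1}(ν)` with the SAME label (it dominates `Z` and inherits, `Labelling.next`).
[cite: CossartJannsenSaito2020, Rem. 6.29 (1)] [cite: GortzWedhorn2020, Prop. 13.91 (3)] -/
theorem exists_component_label_eq_of_not_isBlownUp {s s' : MarkedStage.{u}} (hst : CanonicalNearStep R N ν s s')
    (hg : StateGood k R N ν s.W s.L s.P) (hnb : ¬ s.IsBlownUp R N ν) {Z : Set s.W}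
    (hZ : Z ∈ componentsIn (Scheme.hsStratum s.W N ν)) (hpt : s.pt ∈ Z) :
    ∃ Z' ∈ componentsIn (Scheme.hsStratum s'.W N ν), s'.pt ∈ Z' ∧ s'.L.label Z' = s.L.label Z := by
  obtain ⟨C, P', hln, x', hcs, hπ, -, -, rfl⟩ := hst
  haveI : IsLocallyNoetherian s.W := s.ln
  haveI : IsLocallyNoetherian (blowup C) := hln
  have hg' : StateGood k R N ν (blowup C) (s.L.next (Scheme.hsStratum s.W N ν) C) P' := hg.next hcs
  haveI := hg'.isNoetherian
  have hptE : s.pt ∉ (C.support : Set s.W) := fun h => hnb ⟨C, P', hcs, h⟩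
  have hY := hg.isClosed_hsStratum
  have hY' := hg'.isClosed_hsStratum
  have hπY' : (blowup.π C).base '' Scheme.hsStratum (blowup C) N ν ⊆ Scheme.hsStratum s.W N ν := by
    rintro _ ⟨z, hz, rfl⟩
    exact hg.base_mem_hsStratum hcs hz
  have hST : ∀ T, T ⊆ Scheme.hsStratum s.W N ν →
      strictTransformSet (blowup.π C) (C.support : Set s.W) T ⊆ Scheme.hsStratum (blowup C) N ν :=
    fun T hT => strictTransformSet_subset_hsStratum C hT hY'
  obtain ⟨Z₁, hZ₁, hx'Z₁, hdom⟩ := exists_component_dominating_of_notMem_support C hY hY'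
    (componentsIn.finite _) hπY' hST hZ (y := x') (hπ.symm ▸ hpt) (hπ.symm ▸ hptE)
  refine ⟨Z₁, hZ₁, hx'Z₁, ?_⟩
  have hmem : closure (blowup.π C '' Z₁) ∈ componentsIn (Scheme.hsStratum s.W N ν) := hdom.symm ▸ hZ
  show (s.L.next (Scheme.hsStratum s.W N ν) C).label Z₁ = s.L.label Z
  rw [s.L.next_label_of_mem C hmem, hdom]

/-- Good states hold all along a chain of canonical near steps from a good initial state (`StateGood.next`).
[folklore] -/
theorem stateGood_of_chain {X : Scheme.{u}} [IsLocallyNoetherian X]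
    (hgood : StateGood k R N ν X (Labelling.init X) none) {x : X} {c : ℕ → MarkedStage.{u}}
    (h0 : c 0 = MarkedStage.init X x) (hstep : ∀ n, CanonicalNearStep R N ν (c n) (c (n + 1))) (n : ℕ) :
    StateGood k R N ν (c n).W (c n).L (c n).P := by
  induction n with
  | zero => rw [h0]; exact hgood
  | succ n ih =>
    obtain ⟨C, P', hln, x', hcs, -, -, -, heq⟩ := hstep n
    rw [heq]
    exact ih.next hcs

/-- **A chain that WAITS from stage `n₀` on carries a fixed label at its marked points**: for every `m ≥ n₀` the marked
point `x_m` lies on a component of `X_m(ν)` with the label of the component of `X_{n₀}(ν)` through `x_{n₀}`.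
[cite: CossartJannsenSaito2020, Rem. 6.29 (1)] -/
theorem exists_component_label_eq_of_forall_not_isBlownUp {X : Scheme.{u}} [IsLocallyNoetherian X]
    (hgood : StateGood k R N ν X (Labelling.init X) none) {x : X} {c : ℕ → MarkedStage.{u}}
    (h0 : c 0 = MarkedStage.init X x) (hstep : ∀ n, CanonicalNearStep R N ν (c n) (c (n + 1)))
    {n₀ : ℕ} (hwait : ∀ m, n₀ ≤ m → ¬ (c m).IsBlownUp R N ν) {Z₀ : Set (c n₀).W}
    (hZ₀ : Z₀ ∈ componentsIn (Scheme.hsStratum (c n₀).W N ν)) (hpt₀ : (c n₀).pt ∈ Z₀) {m : ℕ} (hm : n₀ ≤ m) :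
    ∃ Z ∈ componentsIn (Scheme.hsStratum (c m).W N ν), (c m).pt ∈ Z ∧ (c m).L.label Z = (c n₀).L.label Z₀ := by
  induction m, hm using Nat.le_induction with
  | base => exact ⟨Z₀, hZ₀, hpt₀, rfl⟩
  | succ m hm ih =>
    obtain ⟨Z, hZ, hpt, hlab⟩ := ih
    obtain ⟨Z', hZ', hpt', hlab'⟩ := exists_component_label_eq_of_not_isBlownUp (hstep m)
      (stateGood_of_chain hgood h0 hstep m) (hwait m hm) hZ hpt
    exact ⟨Z', hZ', hpt', hlab'.trans hlab⟩

/-- **A chain that waits from some stage on has BOUNDED least label present.** [cite: CossartJannsenSaito2020, Rem. 6.29 (1)] -/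
theorem exists_leastLabel_le_of_forall_not_isBlownUp {X : Scheme.{u}} [IsLocallyNoetherian X]
    (hgood : StateGood k R N ν X (Labelling.init X) none) {x : X} (hx : x ∈ Scheme.hsStratum X N ν)
    {c : ℕ → MarkedStage.{u}} (h0 : c 0 = MarkedStage.init X x)
    (hstep : ∀ n, CanonicalNearStep R N ν (c n) (c (n + 1))) {n₀ : ℕ}
    (hwait : ∀ m, n₀ ≤ m → ¬ (c m).IsBlownUp R N ν) :
    ∃ B, ∀ n, leastLabel N ν (c n) ≤ B := by
  obtain ⟨Z₀, hZ₀, hpt₀⟩ := componentsIn.exists_mem (invariants_of_chain hx h0 hstep n₀).2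
  refine ⟨(c n₀).L.label Z₀, fun n => ?_⟩
  rcases le_or_gt n₀ n with hn | hn
  · obtain ⟨Z, hZ, -, hlab⟩ := exists_component_label_eq_of_forall_not_isBlownUp hgood h0 hstep hwait hZ₀ hpt₀ hn
    exact (leastLabel_le_label N ν (c n) hZ).trans hlab.le
  · exact (leastLabel_monotone_of_chain hx h0 hstep hn.le).trans (leastLabel_le_label N ν (c n₀) hZ₀)

/-- **If the least label present is unbounded along the chain, the marked point is blown up infinitely often**
(hypothesis-light form). [cite: CossartJannsenSaito2020, Rem. 6.29 (1), p. 92] -/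
theorem moving_of_leastLabel_unbounded_of_chain {X : Scheme.{u}} [IsLocallyNoetherian X]
    (hgood : StateGood k R N ν X (Labelling.init X) none) {x : X} (hx : x ∈ Scheme.hsStratum X N ν)
    {c : ℕ → MarkedStage.{u}} (h0 : c 0 = MarkedStage.init X x)
    (hstep : ∀ n, CanonicalNearStep R N ν (c n) (c (n + 1))) (hunb : ∀ B, ∃ n, B < leastLabel N ν (c n)) :
    ∀ n, ∃ m, n ≤ m ∧ (c m).IsBlownUp R N ν := by
  by_contra h
  push Not at h
  obtain ⟨n₀, hwait⟩ := h
  obtain ⟨B, hB⟩ := exists_leastLabel_le_of_forall_not_isBlownUp hgood hx h0 hstep hwait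
  obtain ⟨n, hn⟩ := hunb B
  exact (hB n).not_gt hn

/-- **STUB 2 of the line `moving-compactness`, BY NAME AND SIGNATURE** (idea-2 `Line-moving-compactness.lean`
89d540dcceefd65f): if the least label present is unbounded along the chain,
the chain is MOVING. The oracle and closedness hypotheses are not used (binders `_hRf`, `_hxcl`: the TYPE is the line's
verbatim). [cite: CossartJannsenSaito2020, Rem. 6.29 (1), p. 92] -/
theorem stub_moving_of_leastLabel_unbounded (_hRf : OracleFunctional R) {X : Scheme.{u}} [IsLocallyNoetherian X]
    (hgood : StateGood k R N ν X (Labelling.init X) none) {x : X} (hx : x ∈ Scheme.hsStratum X N ν)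
    (_hxcl : IsClosed ({x} : Set X)) {c : ℕ → MarkedStage.{u}} (h0 : c 0 = MarkedStage.init X x)
    (hstep : ∀ n, CanonicalNearStep R N ν (c n) (c (n + 1))) (hunb : ∀ B, ∃ n, B < leastLabel N ν (c n)) :
    ∀ n, ∃ m, n ≤ m ∧ (c m).IsBlownUp R N ν :=
  moving_of_leastLabel_unbounded_of_chain hgood hx h0 hstep hunb

end Waiting

end Summit.ResolutionOfSingularities.ResolutionOfSingularities.Cruxes.SigmaMaxModifications.MovingCompactnessLine

end
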